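import Summits.QuantumFields.YangMills.Theorems.F4SubCurvatureDoorRationalToGeneralPolyhedralConeSupport
import Mathlib
import HarnessLib

/-!
# Rung R-S1e «DIAGONAL GAIN» BY NAME

Sub-problem `YangMills`, crux ⟨stmt-QuantumFields-23125⟩ `RationalToGeneral.GlobalShortRootRigidity`, stub S1 «FORWARD-CONE SUPPORT»,
rungs file `Cruxes/RationalToGeneral/Lines/forward_cone_rungs.lean` (planner ym-idea-3 g21), rung :151 `DiagonalGain` (L as typed).
The Prop is restated CHARACTER-IDENTICALLY and proved by the unfolded theorem ✓`diagonalGain_unfolded` of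
`…RationalToGeneralPolyhedralConeSupport` (diagonal cones in support form ⇒ the gain along the eight diagonals for every `κ' < 1`,
constants `κ' = (1+κ)/2`, `c = (1−κ)/2`, `C₀ = 1`).

HONEST LABEL: a rung of S1, not S1 (`ForwardConeSupport`, aperture `1` in every direction, stays OPEN — the axis directions `±e_j` are
exactly where the diagonal slices give nothing); the YM mass gap is NOT proved.
-/

noncomputable section

open MeasureTheory Filter Topology Set
open scoped BigOperators

namespace Summit.QuantumFields.YangMills.Theorems.F4SubCurvatureDoorDiagonalGainRegistered

open Summit.QuantumFields.YangMills.Theorems.F4SubCurvatureDoorLaplaceFourierRegistered (E4 E3 InClass timeSpace IsLF)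
open Summit.QuantumFields.YangMills.Theorems.F4SubCurvatureDoorPolyhedralConeSupport (diagonalGain_unfolded)

/-- R-S1e «DIAGONAL GAIN» (L; the FIRST step of the bootstrap, where the engine is visible): a round cone of aperture `κ < 1` for a class kernel
improves along the eight DIAGONAL momentum directions `s⃗/√3`, `s⃗ ∈ {±1}³`.  ENGINE (g21 analysis, see `Ideas/s1-native-cross.md` §Bootstrap engine): at
the point `p⋆ = (t, iκt s⃗/√3)` three frame tubes are simultaneously tangent — `T₀(κ)` and `T_u(κ)`, `T_{u'}(κ)` for `u, u' = (1, ±s⃗)/2` — and their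
tangent complex functionals `ℓ₀ = κ z₀ + i n⃗·z⃗`, `ℓ_u = (κ/2 − i√3/2) z₀ + (κ√3/2 + i/2) n⃗·z⃗` are `ℂ`-proportional iff `κ² = 1` (the 4-D analogue
of `angular_type`'s `(τ² − 1)`); for `κ < 1` the union is locally a tube over a non-convex base in the coordinates `(ℓ₀, ℓ_u, ·, ·)` up to curvature
`O(ε²)`, so the local Bochner tube theorem continues `K` across `p⋆`, and Vivanti–Pringsheim at real time converts that into exponential moments beyond
`κt` in the direction `s⃗/√3`; pinning as in `ConePinning`.  At the AXIS directions `±e_j` only `T₀` is active (no edge), so the first step gains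
nothing there — the iteration lives on `W(B₃)`-symmetric convex bodies, not on round cones (honest open point of `ApertureBootstrap`). -/
def DiagonalGain : Prop :=
  ∀ κ : ℝ, 0 < κ → κ < 1 → ∃ κ' c C₀ : ℝ, κ < κ' ∧ 0 < c ∧ 0 < C₀ ∧
    ∀ (K : E4 → ℝ) (μ : Measure (ℝ × E3)), InClass K → IsLF K μ → μ {p | p.1 < κ * ‖p.2‖} = 0 →
      ∀ (sgn : Fin 3 → Bool) (t : ℝ), 0 < t →
        Integrable (fun p : ℝ × E3 =>
          Real.exp (-(t * p.1) + κ' * t * |∑ j, (if sgn j then (1 : ℝ) else -1) * p.2 j| / Real.sqrt 3)) μ ∧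
        ∫ p : ℝ × E3, Real.exp (-(t * p.1) + κ' * t * |∑ j, (if sgn j then (1 : ℝ) else -1) * p.2 j| / Real.sqrt 3) ∂μ
          ≤ C₀ * K (timeSpace (c * t) 0)


/-- **RUNG R-S1e «DIAGONAL GAIN» (by name).** -/
theorem diagonalGain_holds : DiagonalGain :=
  diagonalGain_unfolded

end Summit.QuantumFields.YangMills.Theorems.F4SubCurvatureDoorDiagonalGainRegistered

end
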